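import Mathlib
import Literature.Computability.Complexity.RangeAvoidance
import Literature.Computability.Complexity.SignDegreeXor
import Summits.PneNP.PneNP.Theorems.IP3ExpandingModel
import Summits.PneNP.PneNP.Theorems.IP3ExpandingCount
import Summits.PneNP.PneNP.Theorems.IP3ExpandingExist
import Summits.PneNP.PneNP.Theorems.IP3Expanding154Count
import Summits.PneNP.PneNP.Theorems.IP3OverlapCount
import Summits.PneNP.PneNP.Theorems.PstarExpandingExist
import Summits.PneNP.PneNP.Theorems.PstarExpanding74Exist

/-!
# Random pure `IP₃` instances at ratio `15/4`, III: the term estimate and existence (cell `pnp-ideate`, w23e)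

FRONTIER range-avoidance ladder, rung F-N3 context (restricted-model combinatorics — nothing here bears on `P` vs `NP`).

The first-moment calculation of `IP3ExpandingExist` re-run at vertex threshold `39/8` (boundary ratio `15/4`): with
`v = v154 s = 5s − ⌈s/8⌉` the exponent bookkeeping `s + v + q = 6s` leaves `q = ⌈s/8⌉ ≥ s/8` factors `v/N`, so the radius is
`N/(5L⁸)` (`term154_le`: `C(m,s)·C(N,v)·(64v⁶/N⁶)^s ≤ 4^{−s}` for `L ≥ 933120K`, `5L⁸s ≤ N`, `m ≤ KN`).  Summing,
`two_mul_card_badSet154_lt`: fewer than HALF of the outcomes are `bad154` at radius `N/(5L⁸)`; with `IP3OverlapCount.two_mul_card_many6_le`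
(at most half have more than `69120K²` output pairs sharing two variables) some outcome is good on both counts (`exists_good154`).
-/

set_option linter.dupNamespace false

open Finset Literature.Computability.Complexity
open Summit.PneNP.PneNP.Theorems.PstarSASDPLevel (BoundaryExpandingQ)
open Summit.PneNP.PneNP.Theorems.IP3ExpandingModel
open Summit.PneNP.PneNP.Theorems.IP3ExpandingCount (cyl6 card_cyl6)
open Summit.PneNP.PneNP.Theorems.IP3ExpandingExist (key_identity6 pow_six_le)
open Summit.PneNP.PneNP.Theorems.IP3Expanding154Count
open Summit.PneNP.PneNP.Theorems.IP3OverlapCount (ovl6 two_mul_card_many6_le)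
open Summit.PneNP.PneNP.Theorems.PstarExpandingExist (choose_le)
open Summit.PneNP.PneNP.Theorems.PstarExpanding74Exist (geom_quarter_lt_half)

namespace Summit.PneNP.PneNP.Theorems.IP3Expanding154Exist

variable {N m : ℕ}

/-- **The term estimate at threshold `39/8`.**  For `1 ≤ s`, `933120K ≤ L`, `5L⁸s ≤ N`, `m ≤ KN`:
`C(m,s)·C(N, v154 s)·(64·(v154 s)⁶/N⁶)^s ≤ 4^{−s}`. -/
theorem term154_le (K L N s m : ℕ) (hs : 1 ≤ s) (hL : 933120 * K ≤ L) (hL1 : 1 ≤ L) (hN : 5 * L ^ 8 * s ≤ N)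
    (hm : m ≤ K * N) :
    (m.choose s : ℝ) * (N.choose (v154 s) : ℝ) * (64 * ((v154 s : ℕ) : ℝ) ^ 6 / (N : ℝ) ^ 6) ^ s ≤ (1 / 4) ^ s := by
  set v := v154 s with hvdef
  set q := (s + 7) / 8 with hqdef
  have hvq : v + q = 5 * s := v154_add s
  have hq1 : 1 ≤ q := by omega
  have hqs : s ≤ 8 * q := by omega
  have hv1 : 1 ≤ v := by omega
  have hv5 : v ≤ 5 * s := by omega
  have hL8 : 1 ≤ L ^ 8 := Nat.one_le_pow _ _ hL1
  have hN1 : 1 ≤ N := by nlinarith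
  have hsR : (0 : ℝ) < s := by exact_mod_cast hs
  have hvR : (0 : ℝ) < v := by exact_mod_cast hv1
  have hNR : (0 : ℝ) < N := by exact_mod_cast hN1
  have hLR : (1 : ℝ) ≤ L := by exact_mod_cast hL1
  have hKR : (0 : ℝ) ≤ K := by positivity
  have hA : (m.choose s : ℝ) ≤ (3 * K * N / s) ^ s := by
    refine (choose_le m s hs).trans (pow_le_pow_left₀ (by positivity) ?_ _)
    have : (m : ℝ) ≤ K * N := by exact_mod_cast hm
    rw [div_le_div_iff_of_pos_right hsR]
    linarith
  have hB : (N.choose v : ℝ) ≤ (3 * N / v) ^ v := choose_le N v hv1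
  have hE : (m.choose s : ℝ) * (N.choose v : ℝ) * (64 * (v : ℝ) ^ 6 / (N : ℝ) ^ 6) ^ s ≤
      (3 * K * N / s) ^ s * (3 * N / v) ^ v * (64 * (v : ℝ) ^ 6 / (N : ℝ) ^ 6) ^ s := by
    have h0 : (0 : ℝ) ≤ (64 * (v : ℝ) ^ 6 / (N : ℝ) ^ 6) ^ s := by positivity
    exact mul_le_mul_of_nonneg_right (mul_le_mul hA hB (by positivity) (by positivity)) h0
  rw [key_identity6 K N v s hsR.ne' hvR.ne' hNR.ne' s v q (by omega)] at hE
  refine hE.trans ?_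
  have f1 : (192 * K * v / s : ℝ) ^ s ≤ (960 * K) ^ s := by
    refine pow_le_pow_left₀ (by positivity) ?_ _
    rw [div_le_iff₀ hsR]
    have : (v : ℝ) ≤ 5 * s := by exact_mod_cast hv5
    nlinarith
  have f2 : (3 : ℝ) ^ v ≤ 243 ^ s := by
    calc (3 : ℝ) ^ v ≤ 3 ^ (5 * s) := pow_le_pow_right₀ (by norm_num) hv5
      _ = 243 ^ s := by rw [pow_mul]; norm_num
  have f3 : ((v : ℝ) / N) ^ q ≤ (1 / L) ^ s := by
    have h1 : (v : ℝ) / N ≤ 1 / L ^ 8 := by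
      rw [div_le_div_iff₀ hNR (by positivity)]
      have : (5 * L ^ 8 * s : ℝ) ≤ N := by exact_mod_cast hN
      have : (v : ℝ) ≤ 5 * s := by exact_mod_cast hv5
      nlinarith
    calc ((v : ℝ) / N) ^ q ≤ (1 / L ^ 8) ^ q := pow_le_pow_left₀ (by positivity) h1 _
      _ = (1 / L) ^ (8 * q) := by rw [div_pow, div_pow, one_pow, one_pow, ← pow_mul]
      _ ≤ (1 / L) ^ s := pow_le_pow_of_le_one (by positivity) (by
          rw [div_le_one (by positivity)]; exact hLR) hqs
  have hprod : (192 * K * v / s : ℝ) ^ s * 3 ^ v * ((v : ℝ) / N) ^ q ≤ (960 * K) ^ s * 243 ^ s * (1 / L) ^ s :=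
    mul_le_mul (mul_le_mul f1 f2 (by positivity) (by positivity)) f3 (by positivity) (by positivity)
  refine hprod.trans ?_
  rw [← mul_pow, ← mul_pow]
  refine pow_le_pow_left₀ (by positivity) ?_ _
  have : (933120 * K : ℝ) ≤ L := by exact_mod_cast hL
  have hL0 : (0 : ℝ) < L := by linarith
  rw [show (960 * K * 243 * (1 / L) : ℝ) = 233280 * K / L by field_simp; ring,
    div_le_div_iff₀ hL0 (by norm_num)]
  linarith

/-- **Most outcomes are good (threshold `39/8`).**  With `L ≥ 933120K`, `N ≥ 10`, `m ≤ KN` and `r = N/(5L⁸)`, fewer than HALF of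
the outcomes are `bad154`. -/
theorem two_mul_card_badSet154_lt (K L N m : ℕ) (hL : 933120 * K ≤ L) (hL1 : 1 ≤ L) (hN : 10 ≤ N) (hm : m ≤ K * N) :
    2 * ((badSet154 N m (N / (5 * L ^ 8))).card : ℝ) < (Fintype.card (Outcome6 N m) : ℝ) := by
  set r := N / (5 * L ^ 8) with hr
  have hL8 : 1 ≤ L ^ 8 := Nat.one_le_pow _ _ hL1
  have hr5 : 5 * r ≤ N := by
    have := Nat.div_mul_le_self N (5 * L ^ 8)
    nlinarith
  set Q : ℕ := Fintype.card (Fin 6 ↪ Fin N) with hQ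
  have hcardΩ : Fintype.card (Outcome6 N m) = Q ^ m := by
    rw [Fintype.card_fun, Fintype.card_fin]
  have hQ64 : (N : ℝ) ^ 6 ≤ 64 * (Q : ℝ) := pow_six_le N hN
  have hNR : (0 : ℝ) < N := by exact_mod_cast (show 0 < N by omega)
  have hQpos : (0 : ℝ) < Q := by
    have : (0 : ℝ) < (N : ℝ) ^ 6 := by positivity
    linarith
  have hub := card_badSet154_le (m := m) r hr5
  have hub2 : 2 * ((badSet154 N m r).card : ℝ) ≤ 2 * ∑ i ∈ Finset.range r,
      (m.choose (i + 1) : ℝ) * (N.choose (v154 (i + 1)) : ℝ) * (((v154 (i + 1) : ℕ) : ℝ) ^ 6) ^ (i + 1) *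
        (Q : ℝ) ^ (m - (i + 1)) := by linarith
  refine lt_of_le_of_lt hub2 ?_
  rw [hcardΩ]
  push_cast
  have hterm : ∀ i ∈ Finset.range r,
      (m.choose (i + 1) : ℝ) * (N.choose (v154 (i + 1)) : ℝ) * ((((v154 (i + 1) : ℕ) : ℝ) ^ 6) ^ (i + 1)) *
          (Q : ℝ) ^ (m - (i + 1)) ≤ (1 / 4) ^ (i + 1) * (Q : ℝ) ^ m := by
    intro i hi
    rw [Finset.mem_range] at hi
    have hs : 5 * L ^ 8 * (i + 1) ≤ N := by
      calc 5 * L ^ 8 * (i + 1) ≤ 5 * L ^ 8 * r := Nat.mul_le_mul_left _ hi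
        _ ≤ N := by rw [hr, Nat.mul_comm]; exact Nat.div_mul_le_self N (5 * L ^ 8)
    have hsm : i + 1 ≤ m ∨ m < i + 1 := le_or_gt _ _
    have ht := term154_le K L N (i + 1) m (by omega) hL hL1 hs hm
    rcases hsm with hsm | hsm
    · have hQsplit : (Q : ℝ) ^ m = (Q : ℝ) ^ (i + 1) * (Q : ℝ) ^ (m - (i + 1)) := by
        rw [← pow_add]; congr 1; omega
      rw [hQsplit]
      have hstep : ((((v154 (i + 1) : ℕ) : ℝ) ^ 6) ^ (i + 1)) ≤
          (64 * ((v154 (i + 1) : ℕ) : ℝ) ^ 6 / (N : ℝ) ^ 6) ^ (i + 1) * (Q : ℝ) ^ (i + 1) := by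
        rw [← mul_pow]
        refine pow_le_pow_left₀ (by positivity) ?_ _
        rw [div_mul_eq_mul_div, le_div_iff₀ (by positivity)]
        have h0 : (0 : ℝ) ≤ ((v154 (i + 1) : ℕ) : ℝ) ^ 6 := by positivity
        nlinarith
      have hQm : (0 : ℝ) ≤ (Q : ℝ) ^ (m - (i + 1)) := by positivity
      have hcc : (0 : ℝ) ≤ (m.choose (i + 1) : ℝ) * (N.choose (v154 (i + 1)) : ℝ) := by positivity
      calc (m.choose (i + 1) : ℝ) * (N.choose (v154 (i + 1)) : ℝ) * (((v154 (i + 1) : ℕ) : ℝ) ^ 6) ^ (i + 1) *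
            (Q : ℝ) ^ (m - (i + 1))
          ≤ (m.choose (i + 1) : ℝ) * (N.choose (v154 (i + 1)) : ℝ) *
            ((64 * ((v154 (i + 1) : ℕ) : ℝ) ^ 6 / (N : ℝ) ^ 6) ^ (i + 1) * (Q : ℝ) ^ (i + 1)) *
              (Q : ℝ) ^ (m - (i + 1)) :=
            mul_le_mul_of_nonneg_right (mul_le_mul_of_nonneg_left hstep hcc) hQm
        _ = ((m.choose (i + 1) : ℝ) * (N.choose (v154 (i + 1)) : ℝ) *
            (64 * ((v154 (i + 1) : ℕ) : ℝ) ^ 6 / (N : ℝ) ^ 6) ^ (i + 1)) *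
              ((Q : ℝ) ^ (i + 1) * (Q : ℝ) ^ (m - (i + 1))) := by ring
        _ ≤ (1 / 4) ^ (i + 1) * ((Q : ℝ) ^ (i + 1) * (Q : ℝ) ^ (m - (i + 1))) :=
            mul_le_mul_of_nonneg_right ht (by positivity)
    · rw [Nat.choose_eq_zero_of_lt hsm]
      simp only [Nat.cast_zero, zero_mul]
      positivity
  have hsum := Finset.sum_le_sum hterm
  rw [← Finset.sum_mul] at hsum
  have hQm : (0 : ℝ) < (Q : ℝ) ^ m := by positivity
  have hg := geom_quarter_lt_half r
  calc 2 * ∑ i ∈ Finset.range r, (m.choose (i + 1) : ℝ) * (N.choose (v154 (i + 1)) : ℝ) *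
        (((v154 (i + 1) : ℕ) : ℝ) ^ 6) ^ (i + 1) * (Q : ℝ) ^ (m - (i + 1))
      ≤ 2 * ((∑ i ∈ Finset.range r, (1 / 4 : ℝ) ^ (i + 1)) * (Q : ℝ) ^ m) := by linarith
    _ < 2 * ((1 / 2) * (Q : ℝ) ^ m) := by nlinarith
    _ = (Q : ℝ) ^ m := by ring

/-- **A good outcome exists (ratio `15/4`, with few overlapping pairs).**  With `L ≥ 933120K`, `N ≥ 10`, `m ≤ KN`: some outcome is not
`bad154` at radius `N/(5L⁸)` and has at most `69120K²` output pairs sharing two variables. -/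
theorem exists_good154 (K L N m : ℕ) (hL : 933120 * K ≤ L) (hL1 : 1 ≤ L) (hN : 10 ≤ N) (hm : m ≤ K * N) :
    ∃ ω : Outcome6 N m, ¬bad154 (N / (5 * L ^ 8)) ω ∧ (ovl6 ω).card ≤ 69120 * K ^ 2 := by
  classical
  set B := badSet154 N m (N / (5 * L ^ 8)) with hB
  set M := univ.filter fun ω : Outcome6 N m => 69120 * K ^ 2 < (ovl6 ω).card with hM
  have h1 : 2 * (B.card : ℝ) < (Fintype.card (Outcome6 N m) : ℝ) := two_mul_card_badSet154_lt K L N m hL hL1 hN hm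
  have h2 : 2 * M.card ≤ Fintype.card (Outcome6 N m) := two_mul_card_many6_le K hN hm
  have h2R : 2 * (M.card : ℝ) ≤ (Fintype.card (Outcome6 N m) : ℝ) := by exact_mod_cast h2
  have hlt : ((B ∪ M).card : ℝ) < (Fintype.card (Outcome6 N m) : ℝ) := by
    have hu : ((B ∪ M).card : ℝ) ≤ (B.card : ℝ) + (M.card : ℝ) := by exact_mod_cast card_union_le B M
    linarith
  have hlt' : (B ∪ M).card < (univ : Finset (Outcome6 N m)).card := by
    rw [card_univ]; exact_mod_cast hlt
  obtain ⟨ω, -, hω⟩ := exists_mem_notMem_of_card_lt_card hlt'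
  rw [mem_union, not_or] at hω
  refine ⟨ω, ?_, ?_⟩
  · intro hbad
    exact hω.1 (by rw [hB, badSet154]; simpa using hbad)
  · have := hω.2
    rw [hM, mem_filter] at this
    push Not at this
    exact this (mem_univ _)

end Summit.PneNP.PneNP.Theorems.IP3Expanding154Exist
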